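import Summits.ResolutionOfSingularities.ResolutionOfSingularities.Theorems.PurelyInseparableDim4ChartAtlasAlgebra
import Summits.ResolutionOfSingularities.ResolutionOfSingularities.Theorems.PurelyInseparableDim4EquimultipleEdge
import HarnessLib

/-!
# Purely inseparable four-folds `z^p + F(x₁, …, x₄)`: the SHEAR re-centring of the `x_l`-chart exists, and its cleaned
# reading is a clean, permissible, non-zero state (brick S3-N1 «atlas of an escaping global centre», part E1b; cell
# `res-dim4-pi`, typ-2 g5)

[OURS · counted 0] (D-0157 DOOR 2; DR-157-C; desk WORD #115 (a) (S3-N1); frame `PIDim4.TerminationImpliesOrderReduction`,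
S3 (c)). Sequel of E1 (`…ChartAtlasAlgebra`): there the shear re-centring `Θ` of the `x_l`-chart (`Θ z = z + g(x)`,
`Θ|_{K[x]} = τ`, `τ x_l = x_l`, `τ x_j = x_j`, `τ xᵢ = xᵢ + bᵢ x_j` (`i ∈ S ∖ {j, l}`), `τ x_k = x_k + b_k` (`k ∉ S`))
was a HYPOTHESIS. PROVED here (no `sorry`, no new axiom):

* §1 `exists_algEquiv_shearBase` — the base shear `τ` of `K[x]` exists as a `K`-algebra automorphism;
  `exists_algEquiv_shear_lift` — every `τ` and cleaning polynomial `g` lift to an automorphism `Θ` of `K[z, x]`;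
* §2 `deletePthPowers_map_eq_zero` (a `K`-algebra map carries sums of `p`-th powers to sums of `p`-th powers),
  **`deletePthPowers_shear_reading_ne_zero`**: for `F ≠ 0` CLEAN with `p ≤ ord_{(x_S)} F`, `l ∈ S`, ANY `K`-automorphism
  `τ` of `K[x]` and any `g`: `clean(g^p + τ F'_l) ≠ 0` — the cleaned reading of the `x_l`-chart is a non-zero clean
  polynomial, as typ-3's member format requires of a state.

Nothing here is a statement about resolution of singularities in dimension ≥ 4 / characteristic `p` (NOT proved anywhere
in this programme). bears_on: LADDER-RESOLUTION:D157-DOOR2 (res-dim4-pi). Supports stmt-ResolutionOfSingularities-16155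
(helper, S3-N1 E1b).
-/

-- every declaration of this summit lives under `Summit.ResolutionOfSingularities.ResolutionOfSingularities`
-- (summit = problem), which the duplicate-namespace linter flags; house convention (cf. the Target file).
set_option linter.dupNamespace false

noncomputable section

open MvPolynomial Finset

namespace Summit.ResolutionOfSingularities.ResolutionOfSingularities.Theorems.PIDim4

open Literature.AlgebraicGeometry.Resolution
open Literature.AlgebraicGeometry.Resolution.Hauser2010
open Literature.AlgebraicGeometry.Resolution.AffinePointBlowup (A)
open Literature.Barriers.ResolutionOfSingularities

namespace ChartDictionary

variable {K : Type} [Field K]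

/-! ## §1 The shear exists -/

/-- **The base shear `τ` of `K[x]`** for the `x_l`-chart: `x_j ↦ x_j`, `x_l ↦ x_l`, `xᵢ ↦ xᵢ + bᵢ x_j` for the other
centre variables `i ∈ S`, `x_k ↦ x_k + b_k` off `S` (inverse: signs flipped). -/
theorem exists_algEquiv_shearBase {S : Finset (Fin 4)} {j l : Fin 4} (hj : j ∈ S) (hl : l ∈ S) (b : Fin 4 → K) :
    ∃ τ : MvPolynomial (Fin 4) K ≃ₐ[K] MvPolynomial (Fin 4) K, τ (X j) = X j ∧ τ (X l) = X l ∧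
      (∀ i ∈ S, i ≠ j → i ≠ l → τ (X i) = X i + C (b i) * X j) ∧ (∀ k ∉ S, τ (X k) = X k + C (b k)) := by
  classical
  let f : Fin 4 → MvPolynomial (Fin 4) K := fun i =>
    if i = j ∨ i = l then X i else if i ∈ S then X i + C (b i) * X j else X i + C (b i)
  let f' : Fin 4 → MvPolynomial (Fin 4) K := fun i =>
    if i = j ∨ i = l then X i else if i ∈ S then X i - C (b i) * X j else X i - C (b i)
  have hfj : aeval f (X j : MvPolynomial (Fin 4) K) = X j := by
    rw [aeval_X]; change (if j = j ∨ j = l then _ else _) = _; rw [if_pos (Or.inl rfl)]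
  have hf'j : aeval f' (X j : MvPolynomial (Fin 4) K) = X j := by
    rw [aeval_X]; change (if j = j ∨ j = l then _ else _) = _; rw [if_pos (Or.inl rfl)]
  refine ⟨AlgEquiv.ofAlgHom (aeval f) (aeval f') ?_ ?_, ?_, ?_, fun i hi hij hil => ?_, fun k hk => ?_⟩
  · refine MvPolynomial.algHom_ext fun i => ?_
    rw [AlgHom.comp_apply, AlgHom.id_apply, aeval_X]
    change aeval f (if i = j ∨ i = l then X i else if i ∈ S then X i - C (b i) * X j else X i - C (b i)) = X i
    by_cases h1 : i = j ∨ i = l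
    · rw [if_pos h1, aeval_X]; change (if i = j ∨ i = l then _ else _) = _; rw [if_pos h1]
    · by_cases h2 : i ∈ S
      · rw [if_neg h1, if_pos h2, map_sub, map_mul, aeval_C, hfj, aeval_X, algebraMap_eq]
        change (if i = j ∨ i = l then _ else _) - _ = _
        rw [if_neg h1, if_pos h2]; ring
      · rw [if_neg h1, if_neg h2, map_sub, aeval_C, aeval_X, algebraMap_eq]
        change (if i = j ∨ i = l then _ else _) - _ = _
        rw [if_neg h1, if_neg h2]; ring
  · refine MvPolynomial.algHom_ext fun i => ?_
    rw [AlgHom.comp_apply, AlgHom.id_apply, aeval_X]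
    change aeval f' (if i = j ∨ i = l then X i else if i ∈ S then X i + C (b i) * X j else X i + C (b i)) = X i
    by_cases h1 : i = j ∨ i = l
    · rw [if_pos h1, aeval_X]; change (if i = j ∨ i = l then _ else _) = _; rw [if_pos h1]
    · by_cases h2 : i ∈ S
      · rw [if_neg h1, if_pos h2, map_add, map_mul, aeval_C, hf'j, aeval_X, algebraMap_eq]
        change (if i = j ∨ i = l then _ else _) + _ = _
        rw [if_neg h1, if_pos h2]; ring
      · rw [if_neg h1, if_neg h2, map_add, aeval_C, aeval_X, algebraMap_eq]
        change (if i = j ∨ i = l then _ else _) + _ = _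
        rw [if_neg h1, if_neg h2]; ring
  · change aeval f (X j) = X j
    exact hfj
  · change aeval f (X l) = X l
    rw [aeval_X]; change (if l = j ∨ l = l then _ else _) = _; rw [if_pos (Or.inr rfl)]
  · change aeval f (X i) = _
    rw [aeval_X]; change (if i = j ∨ i = l then _ else _) = _; rw [if_neg (not_or.mpr ⟨hij, hil⟩), if_pos hi]
  · change aeval f (X k) = _
    have hkj : ¬ (k = j ∨ k = l) := by
      rintro (rfl | rfl)
      · exact hk hj
      · exact hk hl
    rw [aeval_X]; change (if k = j ∨ k = l then _ else _) = _; rw [if_neg hkj, if_neg hk]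

/-- **Lifting a base automorphism and a cleaning polynomial to `K[z, x]`**: for every `τ` and `g` there is `Θ`
with `Θ z = z + g(x)` and `Θ xᵢ = τ xᵢ`. -/
theorem exists_algEquiv_shear_lift (τ : MvPolynomial (Fin 4) K ≃ₐ[K] MvPolynomial (Fin 4) K)
    (g : MvPolynomial (Fin 4) K) :
    ∃ Θ : A 4 K ≃ₐ[K] A 4 K, Θ (X 0) = X 0 + rename Fin.succ g ∧
      ∀ i : Fin 4, Θ (X i.succ) = rename Fin.succ (τ (X i)) := by
  -- the lift of `τ` alone
  let e : Fin (4 + 1) → A 4 K := Fin.cases (X 0) fun i => rename Fin.succ (τ (X i))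
  let e' : Fin (4 + 1) → A 4 K := Fin.cases (X 0) fun i => rename Fin.succ (τ.symm (X i))
  have hce : (aeval e).comp (rename Fin.succ) =
      (rename Fin.succ).comp (τ : MvPolynomial (Fin 4) K →ₐ[K] MvPolynomial (Fin 4) K) := by
    refine MvPolynomial.algHom_ext fun k => ?_
    rw [AlgHom.comp_apply, AlgHom.comp_apply, rename_X, aeval_X, AlgEquiv.coe_toAlgHom]
    rfl
  have hce' : (aeval e').comp (rename Fin.succ) =
      (rename Fin.succ).comp (τ.symm : MvPolynomial (Fin 4) K →ₐ[K] MvPolynomial (Fin 4) K) := by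
    refine MvPolynomial.algHom_ext fun k => ?_
    rw [AlgHom.comp_apply, AlgHom.comp_apply, rename_X, aeval_X, AlgEquiv.coe_toAlgHom]
    rfl
  have he : ∀ G : MvPolynomial (Fin 4) K, aeval e (rename Fin.succ G) = rename Fin.succ (τ G) := fun G =>
    congrArg (fun f : MvPolynomial (Fin 4) K →ₐ[K] A 4 K => f G) hce
  have he' : ∀ G : MvPolynomial (Fin 4) K, aeval e' (rename Fin.succ G) = rename Fin.succ (τ.symm G) := fun G =>
    congrArg (fun f : MvPolynomial (Fin 4) K →ₐ[K] A 4 K => f G) hce'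
  let Ξ : A 4 K ≃ₐ[K] A 4 K := AlgEquiv.ofAlgHom (aeval e) (aeval e') (by
      refine MvPolynomial.algHom_ext fun i => ?_
      refine Fin.cases ?_ (fun k => ?_) i
      · rw [AlgHom.comp_apply, AlgHom.id_apply, aeval_X]
        change aeval e (X 0) = X 0
        rw [aeval_X]; rfl
      · rw [AlgHom.comp_apply, AlgHom.id_apply, aeval_X]
        change aeval e (rename Fin.succ (τ.symm (X k))) = X k.succ
        rw [he, AlgEquiv.apply_symm_apply, rename_X])
    (by
      refine MvPolynomial.algHom_ext fun i => ?_
      refine Fin.cases ?_ (fun k => ?_) i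
      · rw [AlgHom.comp_apply, AlgHom.id_apply, aeval_X]
        change aeval e' (X 0) = X 0
        rw [aeval_X]; rfl
      · rw [AlgHom.comp_apply, AlgHom.id_apply, aeval_X]
        change aeval e' (rename Fin.succ (τ (X k))) = X k.succ
        rw [he', AlgEquiv.symm_apply_apply, rename_X])
  have hΞ0 : Ξ (X 0) = X 0 := by change aeval e (X 0) = X 0; rw [aeval_X]; rfl
  have hΞs : ∀ i : Fin 4, Ξ (X i.succ) = rename Fin.succ (τ (X i)) := fun i => by
    change aeval e (X i.succ) = _; rw [aeval_X]; rfl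
  -- then clean by `g`
  obtain ⟨θ, hθ0, hθs⟩ := exists_algEquiv_clean (K := K) g
  refine ⟨Ξ.trans θ, ?_, fun i => ?_⟩
  · rw [AlgEquiv.trans_apply, hΞ0, hθ0]
  · rw [AlgEquiv.trans_apply, hΞs, clean_rename hθs]

/-! ## §2 The cleaned shear reading is non-zero -/

section NeZero

variable {p : ℕ} [hp : Fact p.Prime] [CharP K p]

/-- A `K`-algebra endomorphism of `K[x]` carries a sum of `p`-th-power monomials to a sum of `p`-th-power monomials:
`clean(G) = 0 ⇒ clean(τ G) = 0` (over a perfect field `G = −h^p`, so `τ G = −(τ h)^p`). -/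
theorem deletePthPowers_map_eq_zero [PerfectRing K p] (τ : MvPolynomial (Fin 4) K →ₐ[K] MvPolynomial (Fin 4) K)
    {G : MvPolynomial (Fin 4) K} (hG : deletePthPowers p G = 0) : deletePthPowers p (τ G) = 0 := by
  obtain ⟨h, hh⟩ := exists_add_pow_eq_deletePthPowers (p := p) 1 G
  rw [pow_one, hG] at hh
  have hG' : G = -h ^ p := eq_neg_of_add_eq_zero_left hh
  have h1 : τ G = (-(τ h)) ^ p + 0 := by
    rw [hG', map_neg, map_pow, add_zero, neg_pow, neg_one_pow_char (MvPolynomial (Fin 4) K) p, neg_one_mul]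
  rw [h1, deletePthPowers_pow_add, deletePthPowers_zero]

/-- **The cleaned reading of the `x_l`-chart is non-zero.** For `F ≠ 0` clean, `p ≤ ord_{(x_S)} F`, `l ∈ S`, any
`K`-algebra automorphism `τ` of `K[x]` and any `g`: `clean(g^p + τ(chartTransform p S l F)) ≠ 0`. (The chart transform of
a clean `F` is clean and non-zero; an automorphism cannot turn a non-zero clean polynomial into a sum of `p`-th powers.) -/
theorem deletePthPowers_shear_reading_ne_zero [PerfectRing K p] {S : Finset (Fin 4)} {l : Fin 4} (hl : l ∈ S)
    {F : MvPolynomial (Fin 4) K} (hF : F ≠ 0) (hclean : HauserPerlega.IsClean p F)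
    (hperm : (p : ℕ∞) ≤ CentreBlowup.ordAlong S F) (τ : MvPolynomial (Fin 4) K ≃ₐ[K] MvPolynomial (Fin 4) K)
    (g : MvPolynomial (Fin 4) K) :
    deletePthPowers p (g ^ p + τ (CentreBlowup.chartTransform p S l F)) ≠ 0 := by
  rw [deletePthPowers_pow_add]
  intro h0
  have hq : ∀ e ∈ F.support, p ≤ CentreBlowup.degIn S e := fun e he => by
    have h : CentreBlowup.ordAlong S F ≤ (CentreBlowup.degIn S e : ℕ∞) := Finset.inf_le he
    exact_mod_cast hperm.trans h
  have hclean' : deletePthPowers p (CentreBlowup.chartTransform p S l F) = CentreBlowup.chartTransform p S l F :=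
    Perm2Bound.deletePthPowers_chartTransform hl hq (HauserPerlega.deletePthPowers_eq_self hclean)
  -- pull back through `τ⁻¹`: `clean(F'_l) = 0`, i.e. `F'_l = 0`
  have h1 := deletePthPowers_map_eq_zero (τ.symm : MvPolynomial (Fin 4) K →ₐ[K] MvPolynomial (Fin 4) K) h0
  rw [AlgEquiv.coe_toAlgHom, AlgEquiv.symm_apply_apply, hclean'] at h1
  exact Equimultiple.chartTransform_ne_zero hl hF hperm h1

end NeZero

end ChartDictionary

end Summit.ResolutionOfSingularities.ResolutionOfSingularities.Theorems.PIDim4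

end
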